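import Summits.CriticalPhenomena.PercolationContinuityZ3.Theorems.PercNearOneGluingNoHeavyPcintOSMCount
import HarnessLib

/-!
# PCINT lane, PHASE 4 (kernel second-moment oriented route), step 3: monotonicity and the balanced bound

Cell `prim-pcint`, seat `prim-pcint-1` (gen 13); memo `run/shared/lean/prim/pcint/T-FIBRE-ROUTE.md` §PHASE 4.

Two elementary inequalities for the meeting probabilities `u d k` of two independent oriented walks:

* `OSM.u_succ_le` / `OSM.u_antitone` : `u d (k+1) ≤ u d k` (the offset pair counts satisfy `cnt k y ≤ cnt k 0` by
  `2ab ≤ a² + b²` over the fibres of the final position, and `cnt (k+1) 0 = Σ_{a,a'} cnt k (e_a − e_{a'})`);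
* `OSM.u_mul_le_B` : `u d (q·d) ≤ B d q := (qd)! / (q!^d · d^{qd})`, the probability of the balanced letter content, which
  dominates the probability of every content because `q^c · q! ≤ q^q · c!` for all `c` (`pow_mul_factorial_le`).
-/

noncomputable section

namespace Summit.CriticalPhenomena.PercolationContinuityZ3.Theorems.Pcint.OSM

open Finset Nat

variable {d : ℕ}

/-! ### Offset pair counts are maximal at offset zero -/

/-- The number of words of length `k` ending at `z`. -/
def nAt (d k : ℕ) (z : Fin d → ℤ) : ℝ := ∑ w : Fin k → Fin d, if pos w k = z then (1 : ℝ) else 0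

/-- `nAt` is nonnegative. -/
theorem nAt_nonneg (k : ℕ) (z : Fin d → ℤ) : 0 ≤ nAt d k z :=
  Finset.sum_nonneg fun _ _ => by split_ifs <;> norm_num

/-- `nAt` vanishes off the set of final positions. -/
theorem nAt_eq_zero {k : ℕ} {z : Fin d → ℤ} (hz : z ∉ (univ : Finset (Fin k → Fin d)).image (fun w => pos w k)) :
    nAt d k z = 0 := by
  refine Finset.sum_eq_zero fun w _ => ?_
  rw [if_neg]
  intro h
  exact hz (mem_image.2 ⟨w, mem_univ _, h⟩)

/-- The offset pair count through the fibres of the final position: `cnt k y = Σ_z nAt z · nAt (z − y)`. -/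
theorem cnt_eq_sum_nAt (k : ℕ) (y : Fin d → ℤ) :
    cnt d k y = ∑ z ∈ (univ : Finset (Fin k → Fin d)).image (fun w => pos w k), nAt d k z * nAt d k (z - y) := by
  unfold cnt
  rw [Finset.sum_comm]
  -- group `w'` by its final position `z`
  rw [← Finset.sum_fiberwise_of_maps_to' (s := (univ : Finset (Fin k → Fin d))) (g := fun w' => pos w' k)
    (fun w' _ => mem_image_of_mem _ (mem_univ w')) (fun z => ∑ w : Fin k → Fin d, if y + pos w k = z then (1 : ℝ) else 0)]
  refine Finset.sum_congr rfl fun z _ => ?_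
  rw [Finset.sum_const, nsmul_eq_mul]
  congr 1
  · rw [nAt, Finset.card_filter]; push_cast
    refine Finset.sum_congr rfl fun w' _ => ?_; simp only [eq_comm]
  · unfold nAt
    refine Finset.sum_congr rfl fun w _ => ?_
    have : y + pos w k = z ↔ pos w k = z - y := by
      constructor <;> intro h
      · rw [← h]; abel
      · rw [h]; abel
    simp only [this]

/-- **Offset pair counts are maximal at offset zero**: `cnt k y ≤ cnt k 0`. -/
theorem cnt_le_cnt_zero (k : ℕ) (y : Fin d → ℤ) : cnt d k y ≤ cnt d k 0 := by
  set Z := (univ : Finset (Fin k → Fin d)).image (fun w => pos w k) with hZ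
  rw [cnt_eq_sum_nAt, cnt_eq_sum_nAt]
  simp only [sub_zero]
  -- `2ab ≤ a² + b²` and a reindexing of the shifted squares
  have hshift : ∑ z ∈ Z, nAt d k (z - y) * nAt d k (z - y) ≤ ∑ z ∈ Z, nAt d k z * nAt d k z := by
    -- keep only the `z` with `z - y ∈ Z`; the others contribute `0`
    have h1 : ∑ z ∈ Z, nAt d k (z - y) * nAt d k (z - y) =
        ∑ z ∈ Z.filter (fun z => z - y ∈ Z), nAt d k (z - y) * nAt d k (z - y) := by
      rw [← Finset.sum_filter_add_sum_filter_not Z (fun z => z - y ∈ Z)]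
      conv_rhs => rw [← add_zero (∑ z ∈ Z.filter (fun z => z - y ∈ Z), nAt d k (z - y) * nAt d k (z - y))]
      congr 1
      refine Finset.sum_eq_zero fun z hz => ?_
      rw [nAt_eq_zero (mem_filter.1 hz).2, mul_zero]
    rw [h1, ← Finset.sum_image (f := fun z' => nAt d k z' * nAt d k z') (s := Z.filter (fun z => z - y ∈ Z))
      (g := fun z => z - y) (fun a _ b _ h => sub_left_injective h)]
    refine Finset.sum_le_sum_of_subset_of_nonneg ?_ fun z _ _ => mul_nonneg (nAt_nonneg k z) (nAt_nonneg k z)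
    intro z' hz'
    obtain ⟨z, hz, rfl⟩ := mem_image.1 hz'
    exact (mem_filter.1 hz).2
  calc ∑ z ∈ Z, nAt d k z * nAt d k (z - y)
      ≤ ∑ z ∈ Z, (nAt d k z * nAt d k z + nAt d k (z - y) * nAt d k (z - y)) / 2 :=
        Finset.sum_le_sum fun z _ => by nlinarith [sq_nonneg (nAt d k z - nAt d k (z - y))]
    _ = (∑ z ∈ Z, nAt d k z * nAt d k z + ∑ z ∈ Z, nAt d k (z - y) * nAt d k (z - y)) / 2 := by
        rw [← Finset.sum_add_distrib, Finset.sum_div]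
    _ ≤ (∑ z ∈ Z, nAt d k z * nAt d k z + ∑ z ∈ Z, nAt d k z * nAt d k z) / 2 := by gcongr
    _ = ∑ z ∈ Z, nAt d k z * nAt d k z := by ring

/-- **Monotonicity**: `u d (k+1) ≤ u d k`. -/
theorem u_succ_le (hd : 0 < d) (k : ℕ) : u d (k + 1) ≤ u d k := by
  unfold u
  have hdpos : (0 : ℝ) < d := by exact_mod_cast hd
  rw [cnt_succ, div_le_div_iff₀ (by positivity) (by positivity)]
  calc (∑ a : Fin d, ∑ a' : Fin d, cnt d k (0 + e a - e a')) * (d : ℝ) ^ (2 * k)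
      ≤ (∑ _a : Fin d, ∑ _a' : Fin d, cnt d k 0) * (d : ℝ) ^ (2 * k) := by
        gcongr with a _ a' _
        exact cnt_le_cnt_zero k _
    _ = cnt d k 0 * (d : ℝ) ^ (2 * (k + 1)) := by
        rw [sum_sum_const]; ring

/-- **`u` is non-increasing.** -/
theorem u_antitone (hd : 0 < d) {m n : ℕ} (h : m ≤ n) : u d n ≤ u d m := by
  induction n, h using Nat.le_induction with
  | base => exact le_rfl
  | succ n _ ih => exact (u_succ_le hd n).trans ih

/-! ### The balanced content dominates -/

/-- `q^c · q! ≤ q^q · c!` for all natural numbers `q, c`. -/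
theorem pow_mul_factorial_le (q c : ℕ) : q ^ c * q ! ≤ q ^ q * c ! := by
  rcases le_or_gt c q with hcq | hqc
  · -- `q! = c! · q(q-1)⋯(c+1) ≤ c! · q^{q-c}`
    have h1 : q ! ≤ c ! * q ^ (q - c) := by
      have := Nat.factorial_mul_descFactorial (Nat.sub_le q c)
      rw [Nat.sub_sub_self hcq] at this
      rw [← this]
      exact Nat.mul_le_mul_left _ (Nat.descFactorial_le_pow _ _)
    calc q ^ c * q ! ≤ q ^ c * (c ! * q ^ (q - c)) := Nat.mul_le_mul_left _ h1
      _ = q ^ (c + (q - c)) * c ! := by rw [pow_add]; ring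
      _ = q ^ q * c ! := by rw [Nat.add_sub_cancel' hcq]
  · -- `c! ≥ q! · (q+1)^{c-q} ≥ q! · q^{c-q}`
    have h1 : q ! * q ^ (c - q) ≤ c ! := by
      calc q ! * q ^ (c - q) ≤ q ! * (q + 1) ^ (c - q) :=
            Nat.mul_le_mul_left _ (Nat.pow_le_pow_left (Nat.le_succ q) _)
        _ ≤ (q + (c - q))! := Nat.factorial_mul_pow_le_factorial
        _ = c ! := by rw [Nat.add_sub_cancel' hqc.le]
    calc q ^ c * q ! = q ^ q * (q ! * q ^ (c - q)) := by
          rw [mul_comm (q !), ← mul_assoc, ← pow_add, Nat.add_sub_cancel' hqc.le]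
      _ ≤ q ^ q * c ! := Nat.mul_le_mul_left _ h1

/-- **The balanced content minimises the factorial product**: `q!^d ≤ ∏ (c j)!` when `Σ c = q·d`. -/
theorem factorial_pow_le_prod (q : ℕ) (c : Fin d → ℕ) (hc : ∑ j, c j = q * d) :
    (q !) ^ d ≤ ∏ j, (c j)! := by
  rcases Nat.eq_zero_or_pos q with hq | hq
  · subst hq
    rw [Nat.factorial_zero, one_pow]
    exact Nat.one_le_iff_ne_zero.2 (Finset.prod_ne_zero_iff.2 fun j _ => Nat.factorial_ne_zero _)
  · have key : q ^ (q * d) * (q !) ^ d ≤ q ^ (q * d) * ∏ j, (c j)! := by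
      have h := Finset.prod_le_prod' (s := (univ : Finset (Fin d))) fun j _ => pow_mul_factorial_le q (c j)
      rw [Finset.prod_mul_distrib, Finset.prod_mul_distrib, Finset.prod_pow_eq_pow_sum, hc, Finset.prod_const,
        Finset.card_univ, Fintype.card_fin, Finset.prod_const, Finset.card_univ, Fintype.card_fin, ← pow_mul] at h
      exact h
    exact Nat.le_of_mul_le_mul_left key (by positivity)

/-- **The balanced probability** `B d q = (qd)! / (q!^d · d^{qd})`: the probability that a uniform word of length
`q·d` has every letter exactly `q` times. -/
def B (d q : ℕ) : ℝ := ((q * d)! : ℝ) / (((q !) : ℝ) ^ d * (d : ℝ) ^ (q * d))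

/-- `B` is positive. -/
theorem B_pos (hd : 0 < d) (q : ℕ) : 0 < B d q := by
  unfold B
  have : (0 : ℝ) < d := by exact_mod_cast hd
  have : (0 : ℝ) < (q ! : ℝ) := by exact_mod_cast Nat.factorial_pos _
  positivity

/-- Every content has at most `(qd)!/q!^d` words. -/
theorem nW_le (q : ℕ) (c : Fin d → ℕ) (hc : ∑ j, c j = q * d) :
    (nW d (q * d) c : ℝ) ≤ ((q * d)! : ℝ) / ((q !) : ℝ) ^ d := by
  rw [nW_eq (q * d) c hc]
  have hP : (0 : ℝ) < ∏ j, ((c j)! : ℝ) := Finset.prod_pos fun _ _ => by exact_mod_cast Nat.factorial_pos _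
  have hQ : (0 : ℝ) < ((q !) : ℝ) ^ d := by
    have : (0 : ℝ) < (q ! : ℝ) := by exact_mod_cast Nat.factorial_pos _
    positivity
  rw [div_le_div_iff₀ hP hQ]
  gcongr
  exact_mod_cast factorial_pow_le_prod q c hc

/-- The total number of words: `Σ_c nW k c = d^k`. -/
theorem sum_nW (k : ℕ) : ∑ c ∈ (univ : Finset (Fin d)).piAntidiag k, (nW d k c : ℝ) = (d : ℝ) ^ k := by
  have h := Finset.card_eq_sum_card_fiberwise (s := (univ : Finset (Fin k → Fin d)))
    (t := (univ : Finset (Fin d)).piAntidiag k) (f := cv) (fun w _ => cv_mem w)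
  rw [Finset.card_univ, Fintype.card_fun, Fintype.card_fin, Fintype.card_fin] at h
  have h' : ((d ^ k : ℕ) : ℝ) = ∑ c ∈ (univ : Finset (Fin d)).piAntidiag k, (nW d k c : ℝ) := by
    rw [h]; push_cast; rfl
  rw [← h']; push_cast; rfl

/-- **`u d (q·d) ≤ B d q`.** -/
theorem u_mul_le_B (hd : 0 < d) (q : ℕ) : u d (q * d) ≤ B d q := by
  unfold u B
  have hdpos : (0 : ℝ) < d := by exact_mod_cast hd
  rw [cnt_zero_eq]
  have hq : (0 : ℝ) < ((q !) : ℝ) ^ d := by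
    have : (0 : ℝ) < (q ! : ℝ) := by exact_mod_cast Nat.factorial_pos _
    positivity
  calc (∑ c ∈ (univ : Finset (Fin d)).piAntidiag (q * d), (nW d (q * d) c : ℝ) ^ 2) / (d : ℝ) ^ (2 * (q * d))
      ≤ (∑ c ∈ (univ : Finset (Fin d)).piAntidiag (q * d),
          ((q * d)! : ℝ) / ((q !) : ℝ) ^ d * (nW d (q * d) c : ℝ)) / (d : ℝ) ^ (2 * (q * d)) := by
        gcongr with c hc
        rw [sq]
        exact mul_le_mul_of_nonneg_right (nW_le q c (mem_piAntidiag.1 hc).1) (Nat.cast_nonneg _)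
    _ = ((q * d)! : ℝ) / (((q !) : ℝ) ^ d * (d : ℝ) ^ (q * d)) := by
        rw [← Finset.mul_sum, sum_nW]
        have : (d : ℝ) ^ (2 * (q * d)) = (d : ℝ) ^ (q * d) * (d : ℝ) ^ (q * d) := by rw [← pow_add]; ring_nf
        rw [this]
        field_simp

end Summit.CriticalPhenomena.PercolationContinuityZ3.Theorems.Pcint.OSM

end
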